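import Mathlib
import Literature.MathematicalPhysics.KineticTheory.LangevinChainReversal
import Literature.MathematicalPhysics.KineticTheory.SdeGeneratorCalculus
import Literature.Analysis.Distribution.FieldIntegrationByParts

/-!
# Uniqueness of the weak steady state (`NessUnique`), part 1: integration by parts and the Fisher identity

Support file for item `stmt-AtomisticToContinuum-0741` (`EmbeddedDrudeMourre.NessUnique`, shared by the
Fourier routes). The Lebesgue transpose of the Langevin generator `L = Y·∇ + ½∑_b D²[v_b,v_b]`
(`sdeGenerator (P.drift N) v_L v_R = P.generator N T_L T_R` on `C²`) is `Lᵀ = L̂ + 2γ`, where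
`L̂ = sdeGenerator (-Y) v_L v_R` is the generator of the time-reversed Langevin equation
(`LangevinChainReversal.lean`; `div Y = -2γ`):

* `integral_sdeGenerator_mul_eq` — **`∫ (L f) g dx = ∫ f (L̂ g + 2γ g) dx`** for `f ∈ C²_c`, `g ∈ C²`
  (smooth potentials, `N ≥ 1`), from the tree's integration by parts for vector fields
  (`Literature.Analysis.Distribution.integral_fieldDeriv_mul`);
* `revGenerator_add_eq_zero_of_weak` — a `C²` function `ρ` that is weakly stationary,
  `∫ (L φ) ρ dx = 0` for all `φ ∈ C_c^∞`, solves the stationary Fokker–Planck equation POINTWISE: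
  `L̂ ρ + 2γ ρ = 0`;
* `integral_generator_mul_comp_eq` — **the entropy-type identity** for such `ρ`, a compactly supported `C²`
  weight `a` and a `C²` profile `F`: `∫ (L a) F(ρ) dx = ∫ a (½ F''(ρ) Γ(ρ,ρ) - 2γ (ρ F'(ρ) - F(ρ))) dx`
  (`Γ = carreDuChamp v_L v_R`), and the resulting **weighted Fisher-information bound**
  `half_integral_weightedFisher_le`: `½ ∫ a F''(ρ) Γ(ρ,ρ) ≤ ℓ (K + 2γ) ∫ θ(ρ)` when `a ≤ 1`, `|L a| ≤ K`,
  `0 ≤ F, sF' - F ≤ ℓ θ` on `[0, ∞)`.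

No definitions; everything is proved.
-/

noncomputable section

open MeasureTheory Filter Topology Set
open scoped ContDiff NNReal ENNReal

namespace Summit.AtomisticToContinuum.FouriersLaw.Theorems.NessUnique

open Literature.MathematicalPhysics.KineticTheory.HeatConduction
open Literature.MathematicalPhysics.KineticTheory OscillatorChain
open Literature.Analysis.Distribution

variable {N : ℕ}

/-! ### Second derivatives along a constant vector field -/

/-- `D²f(x)[v, v] = X(Xf)(x)` for the constant field `X ≡ v` and `f ∈ C²`. [folklore] -/
theorem fderiv_fderiv_apply_eq_fieldDeriv {f : PhaseSpace N → ℝ} (hf : ContDiff ℝ 2 f)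
    (v x : PhaseSpace N) :
    fderiv ℝ (fderiv ℝ f) x v v = fieldDeriv (fun _ => v) (fieldDeriv (fun _ => v) f) x := by
  have hd : DifferentiableAt ℝ (fderiv ℝ f) x :=
    ((hf.fderiv_right (m := 1) (by norm_num)).differentiable (by norm_num)) x
  have e : fieldDeriv (fun _ => v) f = fun y => (fderiv ℝ f y) v := by
    funext y; rfl
  rw [fieldDeriv_apply, e, fderiv_clm_apply hd (differentiableAt_const v)]
  simp

/-- `y ↦ Df(y)·v` is `C¹` for `f ∈ C²`. [folklore] -/
theorem contDiff_one_fieldDeriv_const {f : PhaseSpace N → ℝ} (hf : ContDiff ℝ 2 f) (v : PhaseSpace N) :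
    ContDiff ℝ 1 (fieldDeriv (fun _ => v) f) := by
  have e : fieldDeriv (fun _ => v) f = fun y => (fderiv ℝ f y) v := by
    funext y; rfl
  rw [e]
  exact (hf.fderiv_right (m := 1) (by norm_num)).clm_apply contDiff_const

/-- Integration by parts twice along a constant field: `∫ D²f[v,v] g dx = ∫ f D²g[v,v] dx` for
`f ∈ C²_c`, `g ∈ C²`. [folklore] -/
theorem integral_fderiv_fderiv_mul_eq {f g : PhaseSpace N → ℝ} (hf : ContDiff ℝ 2 f) (hg : ContDiff ℝ 2 g)
    (hfc : HasCompactSupport f) (v : PhaseSpace N) :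
    ∫ x, fderiv ℝ (fderiv ℝ f) x v v * g x = ∫ x, f x * fderiv ℝ (fderiv ℝ g) x v v := by
  haveI := isAddHaarMeasure_volume_phaseSpace N
  have hX : ContDiff ℝ 1 (fun _ : PhaseSpace N => v) := contDiff_const
  have hf1 : ContDiff ℝ 1 f := hf.of_le (by norm_num)
  have hg1 : ContDiff ℝ 1 g := hg.of_le (by norm_num)
  simp_rw [fderiv_fderiv_apply_eq_fieldDeriv hf, fderiv_fderiv_apply_eq_fieldDeriv hg]
  rw [integral_fieldDeriv_mul (μ := volume) hX (contDiff_one_fieldDeriv_const hf v) hg1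
    (hasCompactSupport_fieldDeriv _ hfc)]
  have e1 : (fun x => fieldDeriv (fun _ => v) f x * fieldTranspose (fun _ => v) g x) =
      fun x => -(fieldDeriv (fun _ => v) f x * fieldDeriv (fun _ => v) g x) := by
    funext x
    simp only [fieldTranspose_const, fieldDeriv_apply]
    ring
  rw [e1, integral_neg, integral_fieldDeriv_mul (μ := volume) hX hf1 (contDiff_one_fieldDeriv_const hg v) hfc]
  have e2 : (fun x => f x * fieldTranspose (fun _ => v) (fieldDeriv (fun _ => v) g) x) =
      fun x => -(f x * fieldDeriv (fun _ => v) (fieldDeriv (fun _ => v) g) x) := by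
    funext x
    simp only [fieldTranspose_const, fieldDeriv_apply]
    ring
  rw [e2, integral_neg, neg_neg]

/-! ### `∫ (L f) g = ∫ f (L̂ g + 2γ g)` -/

variable (P : OscillatorChain)

/-- **The Lebesgue transpose of the Langevin generator is `L̂ + 2γ`**: for smooth potentials,
`N ≥ 1`, `f ∈ C²_c` and `g ∈ C²`,
`∫ (L f) g dx = ∫ f (L̂ g + 2γ g) dx`, `L = sdeGenerator Y v_L v_R`, `L̂ = sdeGenerator (-Y) v_L v_R`
(`div Y = -2γ`; the second-order part is symmetric). [cite: CuneoEckmannHairerReyBellet2018, §3.1] -/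
theorem integral_sdeGenerator_mul_eq (hU : ContDiff ℝ ∞ P.U) (hV : ContDiff ℝ ∞ P.V) (hN : 0 < N)
    (T_L T_R : ℝ) {f g : PhaseSpace N → ℝ} (hf : ContDiff ℝ 2 f) (hg : ContDiff ℝ 2 g)
    (hfc : HasCompactSupport f) :
    ∫ x, sdeGenerator (P.drift N) (P.bathVecL N T_L) (P.bathVecR N T_R) f x * g x =
      ∫ x, f x * (sdeGenerator (fun y => -P.drift N y) (P.bathVecL N T_L) (P.bathVecR N T_R) g x +
        2 * P.γ * g x) := by
  haveI := isAddHaarMeasure_volume_phaseSpace N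
  set vL := P.bathVecL N T_L
  set vR := P.bathVecR N T_R
  have hY : ContDiff ℝ 1 (P.drift N) := (P.contDiff_drift hU hV N).of_le (by exact_mod_cast le_top)
  have hYc : Continuous (P.drift N) := hY.continuous
  have hf1 : ContDiff ℝ 1 f := hf.of_le (by norm_num)
  have hg1 : ContDiff ℝ 1 g := hg.of_le (by norm_num)
  have hfd : Differentiable ℝ f := hf.differentiable (by norm_num)
  have hgd : Differentiable ℝ g := hg.differentiable (by norm_num)
  have hf2c : Continuous (fderiv ℝ (fderiv ℝ f)) :=
    (hf.fderiv_right (m := 1) (by norm_num)).continuous_fderiv (by norm_num)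
  have hg2c : Continuous (fderiv ℝ (fderiv ℝ g)) :=
    (hg.fderiv_right (m := 1) (by norm_num)).continuous_fderiv (by norm_num)
  have hf1c : Continuous (fderiv ℝ f) := hf.continuous_fderiv (by norm_num)
  have hg1c : Continuous (fderiv ℝ g) := hg.continuous_fderiv (by norm_num)
  -- first-order part
  have h1 : ∫ x, fderiv ℝ f x (P.drift N x) * g x =
      ∫ x, f x * (fderiv ℝ g x (-P.drift N x) + 2 * P.γ * g x) := by
    have h := integral_fieldDeriv_mul (μ := volume) hY hf1 hg1 hfc
    simp only [fieldDeriv_apply] at h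
    rw [h]
    refine integral_congr_ae (Eventually.of_forall fun x => ?_)
    simp only [fieldTranspose, fieldDeriv_apply, P.fieldDiv_drift hU hV hN, map_neg]
    ring
  -- second-order parts
  have h2 : ∀ v : PhaseSpace N, ∫ x, fderiv ℝ (fderiv ℝ f) x v v * g x =
      ∫ x, f x * fderiv ℝ (fderiv ℝ g) x v v := fun v => integral_fderiv_fderiv_mul_eq hf hg hfc v
  -- continuity and compact support of the pieces
  have cB : ∀ (h : PhaseSpace N → ℝ), ContDiff ℝ 2 h → ∀ v : PhaseSpace N,
      Continuous fun x => fderiv ℝ (fderiv ℝ h) x v v := fun h hh v =>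
    ((((hh.fderiv_right (m := 1) (by norm_num)).continuous_fderiv (by norm_num)).clm_apply
      continuous_const).clm_apply continuous_const)
  have sB : ∀ v : PhaseSpace N, HasCompactSupport fun x => fderiv ℝ (fderiv ℝ f) x v v := fun v => by
    have e : (fun x => fderiv ℝ (fderiv ℝ f) x v v) =
        fieldDeriv (fun _ => v) (fieldDeriv (fun _ => v) f) := funext fun x =>
      fderiv_fderiv_apply_eq_fieldDeriv hf v x
    rw [e]
    exact hasCompactSupport_fieldDeriv _ (hasCompactSupport_fieldDeriv _ hfc)
  have iA : Integrable (fun x => fderiv ℝ f x (P.drift N x) * g x) :=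
    ((continuous_fieldDeriv hYc hf1).mul hg.continuous).integrable_of_hasCompactSupport
      ((hasCompactSupport_fieldDeriv (P.drift N) hfc).mul_right)
  have iB : ∀ v : PhaseSpace N, Integrable (fun x => fderiv ℝ (fderiv ℝ f) x v v * g x) := fun v =>
    ((cB f hf v).mul hg.continuous).integrable_of_hasCompactSupport ((sB v).mul_right)
  have iA' : Integrable (fun x => f x * (fderiv ℝ g x (-P.drift N x) + 2 * P.γ * g x)) :=
    (hf.continuous.mul ((hg1c.clm_apply hYc.neg).add (continuous_const.mul hg.continuous))).integrable_of_hasCompactSupport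
      hfc.mul_right
  have iB' : ∀ v : PhaseSpace N, Integrable (fun x => f x * fderiv ℝ (fderiv ℝ g) x v v) := fun v =>
    (hf.continuous.mul (cB g hg v)).integrable_of_hasCompactSupport hfc.mul_right
  -- expand both sides
  have eL : (fun x => sdeGenerator (P.drift N) vL vR f x * g x) = fun x =>
      fderiv ℝ f x (P.drift N x) * g x +
        (1 / 2) * (fderiv ℝ (fderiv ℝ f) x vL vL * g x + fderiv ℝ (fderiv ℝ f) x vR vR * g x) := by
    funext x; rw [sdeGenerator_def]; ring
  have eR : (fun x => f x * (sdeGenerator (fun y => -P.drift N y) vL vR g x + 2 * P.γ * g x)) = fun x =>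
      f x * (fderiv ℝ g x (-P.drift N x) + 2 * P.γ * g x) +
        (1 / 2) * (f x * fderiv ℝ (fderiv ℝ g) x vL vL + f x * fderiv ℝ (fderiv ℝ g) x vR vR) := by
    funext x; rw [sdeGenerator_def]; ring
  have iS : Integrable (fun x => (1 : ℝ) / 2 *
      (fderiv ℝ (fderiv ℝ f) x vL vL * g x + fderiv ℝ (fderiv ℝ f) x vR vR * g x)) := by
    exact ((iB vL).add (iB vR)).const_mul _
  have iS' : Integrable (fun x => (1 : ℝ) / 2 *
      (f x * fderiv ℝ (fderiv ℝ g) x vL vL + f x * fderiv ℝ (fderiv ℝ g) x vR vR)) := by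
    exact ((iB' vL).add (iB' vR)).const_mul _
  rw [eL, eR, integral_add iA iS, integral_add iA' iS', integral_const_mul, integral_const_mul,
    integral_add (iB vL) (iB vR), integral_add (iB' vL) (iB' vR), h1, h2 vL, h2 vR]

/-! ### Weak stationarity of a `C²` density is the pointwise stationary Fokker–Planck equation -/

/-- `L̂ g + 2γ g` is continuous for `g ∈ C²` and smooth potentials. [folklore] -/
theorem continuous_revGenerator_add (hU : ContDiff ℝ ∞ P.U) (hV : ContDiff ℝ ∞ P.V) (T_L T_R : ℝ)
    {g : PhaseSpace N → ℝ} (hg : ContDiff ℝ 2 g) :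
    Continuous fun x => sdeGenerator (fun y => -P.drift N y) (P.bathVecL N T_L) (P.bathVecR N T_R) g x +
      2 * P.γ * g x :=
  (continuous_sdeGenerator _ _ (P.contDiff_drift hU hV N).continuous.neg hg).add
    (continuous_const.mul hg.continuous)

/-- **A weakly stationary `C²` density solves `L̂ ρ + 2γ ρ = 0` pointwise.** If `ρ ∈ C²` and
`∫ (L φ) ρ dx = 0` for every `φ ∈ C_c^∞` (`L = P.generator N T_L T_R`, smooth potentials, `N ≥ 1`,
`γT_L, γT_R ≥ 0`), then `L̂ ρ(x) + 2γ ρ(x) = 0` for every `x`: by `integral_sdeGenerator_mul_eq` the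
continuous function `L̂ρ + 2γρ` is orthogonal to all test functions.
[cite: CuneoEckmannHairerReyBellet2018, §3.1] -/
theorem revGenerator_add_eq_zero_of_weak (hU : ContDiff ℝ ∞ P.U) (hV : ContDiff ℝ ∞ P.V) (hN : 0 < N)
    {T_L T_R : ℝ} (hL : 0 ≤ P.γ * T_L) (hR : 0 ≤ P.γ * T_R) {ρ : PhaseSpace N → ℝ} (hρ : ContDiff ℝ 2 ρ)
    (hweak : ∀ φ : PhaseSpace N → ℝ, ContDiff ℝ ∞ φ → HasCompactSupport φ →
      ∫ x, P.generator N T_L T_R φ x * ρ x = 0) (x : PhaseSpace N) :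
    sdeGenerator (fun y => -P.drift N y) (P.bathVecL N T_L) (P.bathVecR N T_R) ρ x + 2 * P.γ * ρ x = 0 := by
  haveI := isAddHaarMeasure_volume_phaseSpace N
  set w : PhaseSpace N → ℝ := fun x =>
    sdeGenerator (fun y => -P.drift N y) (P.bathVecL N T_L) (P.bathVecR N T_R) ρ x + 2 * P.γ * ρ x with hw
  have hwc : Continuous w := continuous_revGenerator_add P hU hV T_L T_R hρ
  have horth : ∀ φ : PhaseSpace N → ℝ, ContDiff ℝ ∞ φ → HasCompactSupport φ →
      ∫ x, φ x • w x = 0 := by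
    intro φ hφ hφc
    have hφ2 : ContDiff ℝ 2 φ := hφ.of_le (by norm_cast)
    have h := integral_sdeGenerator_mul_eq P hU hV hN T_L T_R hφ2 hρ hφc
    rw [P.sdeGenerator_drift_eq_generator hN hL hR hφ2] at h
    rw [← hweak φ hφ hφc, h]
    rfl
  have hae : ∀ᵐ x ∂(volume : Measure (PhaseSpace N)), w x = 0 :=
    ae_eq_zero_of_integral_contDiff_smul_eq_zero (hwc.locallyIntegrable) horth
  have hzero : w = 0 := by
    have h := (hwc.ae_eq_iff_eq (μ := volume) continuous_const).1 hae
    exact h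
  exact congrFun hzero x

/-! ### `C²` functions of one variable from two derivatives -/

/-- A real function with a derivative `F'` which has a continuous derivative `F''` is `C²`.
[folklore] -/
theorem contDiff_two_of_hasDerivAt {F F' F'' : ℝ → ℝ} (hF : ∀ u, HasDerivAt F (F' u) u)
    (hF' : ∀ u, HasDerivAt F' (F'' u) u) (hF'' : Continuous F'') : ContDiff ℝ 2 F := by
  have hd : deriv F = F' := funext fun u => (hF u).deriv
  have hd' : deriv F' = F'' := funext fun u => (hF' u).deriv
  have h1 : ContDiff ℝ 1 F' := by
    rw [show (1 : WithTop ℕ∞) = 0 + 1 from rfl, contDiff_succ_iff_deriv]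
    exact ⟨fun u => (hF' u).differentiableAt, fun h => absurd h (by simp), by
      rw [hd']; exact contDiff_zero.2 hF''⟩
  rw [show (2 : WithTop ℕ∞) = 1 + 1 from rfl, contDiff_succ_iff_deriv]
  exact ⟨fun u => (hF u).differentiableAt, fun h => absurd h (by simp), by rwa [hd]⟩

/-! ### The entropy-type identity -/

variable (P : OscillatorChain)

/-- **The entropy-type identity behind the Fisher-information bound.** For smooth potentials,
`N ≥ 1`, a `C²` solution `ρ` of `L̂ρ + 2γρ = 0`, a compactly supported `C²` weight `a` and
`F : ℝ → ℝ` with derivatives `F'`, `F''` (`F''` continuous):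
`∫ (L a) F(ρ) dx = ∫ a (½ F''(ρ) Γ(ρ,ρ) - 2γ (ρ F'(ρ) - F(ρ))) dx`. [folklore] -/
theorem integral_generator_mul_comp_eq (hU : ContDiff ℝ ∞ P.U) (hV : ContDiff ℝ ∞ P.V) (hN : 0 < N)
    (T_L T_R : ℝ) {ρ : PhaseSpace N → ℝ} (hρ : ContDiff ℝ 2 ρ)
    (hpde : ∀ x, sdeGenerator (fun y => -P.drift N y) (P.bathVecL N T_L) (P.bathVecR N T_R) ρ x +
      2 * P.γ * ρ x = 0)
    {F F' F'' : ℝ → ℝ} (hF : ∀ u, HasDerivAt F (F' u) u) (hF' : ∀ u, HasDerivAt F' (F'' u) u)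
    (hF'' : Continuous F'') {a : PhaseSpace N → ℝ} (ha : ContDiff ℝ 2 a) (hac : HasCompactSupport a) :
    ∫ x, sdeGenerator (P.drift N) (P.bathVecL N T_L) (P.bathVecR N T_R) a x * F (ρ x) =
      ∫ x, a x * ((1 / 2) * F'' (ρ x) *
          carreDuChamp (P.bathVecL N T_L) (P.bathVecR N T_R) ρ ρ x -
        2 * P.γ * (ρ x * F' (ρ x) - F (ρ x))) := by
  have hFρ : ContDiff ℝ 2 fun x => F (ρ x) := (contDiff_two_of_hasDerivAt hF hF' hF'').comp hρ
  rw [integral_sdeGenerator_mul_eq P hU hV hN T_L T_R ha hFρ hac]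
  refine integral_congr_ae (Eventually.of_forall fun x => ?_)
  show a x * (sdeGenerator (fun y => -P.drift N y) (P.bathVecL N T_L) (P.bathVecR N T_R)
      (fun y => F (ρ y)) x + 2 * P.γ * F (ρ x)) = _
  rw [sdeGenerator_comp_eq (fun y => -P.drift N y) _ _ hF hF' hρ x]
  have h := hpde x
  have e : sdeGenerator (fun y => -P.drift N y) (P.bathVecL N T_L) (P.bathVecR N T_R) ρ x =
      -(2 * P.γ * ρ x) := by linarith
  rw [e]
  ring

/-! ### The weighted Fisher-information bound -/

/-- **The weighted Fisher-information bound.** In the setting of `integral_generator_mul_comp_eq`,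
assume moreover `a ≤ 1`, `|L a| ≤ K`, `ρ ≥ 0`, `γ ≥ 0`, and that on `s ≥ 0` the convex profile
satisfies `0 ≤ F(s) ≤ ℓ θ(s)` and `0 ≤ s F'(s) - F(s) ≤ ℓ θ(s)` with `θ(ρ)` integrable. Then `½ ∫ a F''(ρ) Γ(ρ,ρ) dx ≤ ℓ (K + 2γ) ∫ θ(ρ) dx`. With `F'' = φ(s)/(s+δ)`-type
profiles this controls `∫ a φ(ρ)|∂_{p_b}ρ|²/(ρ+δ)` by the mass of `ρ` only. [folklore] -/
theorem half_integral_weightedFisher_le (hU : ContDiff ℝ ∞ P.U) (hV : ContDiff ℝ ∞ P.V) (hN : 0 < N)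
    (hγ : 0 ≤ P.γ) (T_L T_R : ℝ) {ρ : PhaseSpace N → ℝ} (hρ : ContDiff ℝ 2 ρ) (hρ0 : ∀ x, 0 ≤ ρ x)
    (hpde : ∀ x, sdeGenerator (fun y => -P.drift N y) (P.bathVecL N T_L) (P.bathVecR N T_R) ρ x +
      2 * P.γ * ρ x = 0)
    {F F' F'' : ℝ → ℝ} (hF : ∀ u, HasDerivAt F (F' u) u) (hF' : ∀ u, HasDerivAt F' (F'' u) u)
    (hF'' : Continuous F'') {θ : ℝ → ℝ} {ℓ : ℝ}
    (hF0 : ∀ s, 0 ≤ s → 0 ≤ F s) (hFθ : ∀ s, 0 ≤ s → F s ≤ ℓ * θ s)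
    (hG0 : ∀ s, 0 ≤ s → 0 ≤ s * F' s - F s) (hGθ : ∀ s, 0 ≤ s → s * F' s - F s ≤ ℓ * θ s)
    (hθint : Integrable fun x => θ (ρ x))
    {a : PhaseSpace N → ℝ} (ha : ContDiff ℝ 2 a) (hac : HasCompactSupport a)
    (ha1 : ∀ x, a x ≤ 1) {K : ℝ}
    (hK : ∀ x, |sdeGenerator (P.drift N) (P.bathVecL N T_L) (P.bathVecR N T_R) a x| ≤ K) :
    (1 / 2) * ∫ x, a x * (F'' (ρ x) * carreDuChamp (P.bathVecL N T_L) (P.bathVecR N T_R) ρ ρ x) ≤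
      ℓ * (K + 2 * P.γ) * ∫ x, θ (ρ x) := by
  set vL := P.bathVecL N T_L
  set vR := P.bathVecR N T_R
  set La := sdeGenerator (P.drift N) vL vR a with hLa
  set Γ := carreDuChamp vL vR ρ ρ with hΓ
  have hYc : Continuous (P.drift N) := (P.contDiff_drift hU hV N).continuous
  have hFc : Continuous F := continuous_iff_continuousAt.2 fun u => (hF u).continuousAt
  have hF'c : Continuous F' := continuous_iff_continuousAt.2 fun u => (hF' u).continuousAt
  have hρc : Continuous ρ := hρ.continuous
  have hρ1c : Continuous (fderiv ℝ ρ) := hρ.continuous_fderiv (by norm_num)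
  have hΓc : Continuous Γ := by
    have e : Γ = fun y => fderiv ℝ ρ y vL * fderiv ℝ ρ y vL + fderiv ℝ ρ y vR * fderiv ℝ ρ y vR :=
      funext fun y => carreDuChamp_def vL vR ρ ρ y
    rw [e]
    exact ((hρ1c.clm_apply continuous_const).mul (hρ1c.clm_apply continuous_const)).add
      ((hρ1c.clm_apply continuous_const).mul (hρ1c.clm_apply continuous_const))
  have hLac : Continuous La := continuous_sdeGenerator _ _ hYc ha
  have hLasupp : HasCompactSupport La := hasCompactSupport_sdeGenerator _ _ hac
  have hK0 : 0 ≤ K := (abs_nonneg _).trans (hK 0)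
  -- integrability
  have i1 : Integrable (fun x => La x * F (ρ x)) :=
    (hLac.mul (hFc.comp hρc)).integrable_of_hasCompactSupport hLasupp.mul_right
  have i2 : Integrable (fun x => a x * ((1 / 2) * F'' (ρ x) * Γ x)) :=
    (ha.continuous.mul ((continuous_const.mul (hF''.comp hρc)).mul hΓc)).integrable_of_hasCompactSupport
      hac.mul_right
  have i3 : Integrable (fun x => a x * (2 * P.γ * (ρ x * F' (ρ x) - F (ρ x)))) :=
    (ha.continuous.mul (continuous_const.mul ((hρc.mul (hF'c.comp hρc)).sub (hFc.comp hρc)))).integrable_of_hasCompactSupport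
      hac.mul_right
  -- the identity, rearranged
  have key := integral_generator_mul_comp_eq P hU hV hN T_L T_R hρ hpde hF hF' hF'' ha hac
  have e1 : (fun x => a x * ((1 / 2) * F'' (ρ x) * Γ x - 2 * P.γ * (ρ x * F' (ρ x) - F (ρ x)))) =
      fun x => a x * ((1 / 2) * F'' (ρ x) * Γ x) - a x * (2 * P.γ * (ρ x * F' (ρ x) - F (ρ x))) := by
    funext x; ring
  rw [e1, integral_sub i2 i3] at key
  have e2 : (1 / 2) * ∫ x, a x * (F'' (ρ x) * Γ x) = ∫ x, a x * ((1 / 2) * F'' (ρ x) * Γ x) := by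
    rw [← integral_const_mul]
    refine integral_congr_ae (Eventually.of_forall fun x => ?_)
    ring
  rw [e2]
  have h12 : ∫ x, a x * ((1 / 2) * F'' (ρ x) * Γ x) =
      (∫ x, La x * F (ρ x)) + ∫ x, a x * (2 * P.γ * (ρ x * F' (ρ x) - F (ρ x))) := by linarith
  rw [h12]
  -- bound the two terms
  have hb1 : ∫ x, La x * F (ρ x) ≤ ∫ x, K * (ℓ * θ (ρ x)) := by
    refine integral_mono i1 ((hθint.const_mul ℓ).const_mul K) fun x => ?_
    have hFx0 := hF0 _ (hρ0 x)
    have hFx := hFθ _ (hρ0 x)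
    calc La x * F (ρ x) ≤ |La x| * F (ρ x) :=
          mul_le_mul_of_nonneg_right (le_abs_self _) hFx0
      _ ≤ K * (ℓ * θ (ρ x)) := mul_le_mul (hK x) hFx hFx0 hK0
  have hb2 : ∫ x, a x * (2 * P.γ * (ρ x * F' (ρ x) - F (ρ x))) ≤ ∫ x, 2 * P.γ * (ℓ * θ (ρ x)) := by
    refine integral_mono i3 ((hθint.const_mul ℓ).const_mul (2 * P.γ)) fun x => ?_
    have hGx0 := hG0 _ (hρ0 x)
    have hGx := hGθ _ (hρ0 x)
    have h2γ : 0 ≤ 2 * P.γ := by linarith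
    calc a x * (2 * P.γ * (ρ x * F' (ρ x) - F (ρ x))) ≤ 1 * (2 * P.γ * (ρ x * F' (ρ x) - F (ρ x))) :=
          mul_le_mul_of_nonneg_right (ha1 x) (mul_nonneg h2γ hGx0)
      _ ≤ 2 * P.γ * (ℓ * θ (ρ x)) := by rw [one_mul]; exact mul_le_mul_of_nonneg_left hGx h2γ
  rw [integral_const_mul, integral_const_mul] at hb1
  rw [integral_const_mul, integral_const_mul] at hb2
  have : K * (ℓ * ∫ x, θ (ρ x)) + 2 * P.γ * (ℓ * ∫ x, θ (ρ x)) = ℓ * (K + 2 * P.γ) * ∫ x, θ (ρ x) := by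
    ring
  linarith

end Summit.AtomisticToContinuum.FouriersLaw.Theorems.NessUnique

end
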